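import Summits.CriticalPhenomena.PercolationContinuityZ3.Theorems.FK.Transplant.KNFreeScheme
import HarnessLib

/-!
# FK-continuity transplant, FT-07 (b): the run of the FK exploration process — explored edges, the run invariant,
# (29) and (31) (law-free port of `KozmaNitzanTheorem6.lean` ll. 60–466 with `schemeFK`)

Cell `fk-continuity` (bschramm), FRONTIER TRANSPLANT sub-cell, row FT-07 (`KNFreeTheorem6`, part b: run
invariants); support file (`--supports stmt-CriticalPhenomena-4575`); builds on p205010 (kernel theorem, internal
audit signed; external expert review pending). HONEST FRAMING: the transplant this file serves is CONDITIONAL on the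
free-boundary penetration hypothesis FH (open at the same `p` for `q > 1`; ⇔ GRC Conj. (5.103) via K1; barrier note
`Literature.Barriers.CriticalPhenomena.SamePFreeBoundaryCriteria`); a typed reduction, not a proof of FK continuity.
THIS file is law-free combinatorics of the run: no named facts, no sorries, standard axioms; `FH` does not occur.

## What is here

Along the run of the FK exploration process `schemeFK S q` (FT-06a `KNFreeScheme.lean`) on a configuration `ω`:
the history `RunFK.hst`, the three cases of a step, the evolution of the explored edges / region / pattern
(`step_none`, `step_some`, `F_mono`, `V_mono`, `V_step`), the RUN INVARIANT `RunInv` / `runInv` (explored edges =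
lattice edges of the explored region; pattern = `ω` on them with `U₀` open; region = `Q_0` ∪ new regions of the
probes made; (29): cubes of determined macro-vertices are explored); its consequences ((29) both ways, the
cover, (31)) are `KNFreeRunCover.lean`. Verbatim port of Kozma–Nitzan Theorem 6's run (tree `KozmaNitzanTheorem6.lean`,
KN arXiv:2401.12397 §4 pp. 26–28) with the FK scheme in place of the `q = 1` scheme; the (32)-transfer along the
run (part c) and lawfulness (part d) follow in separate files.

## References

* G. Kozma, S. Nitzan, arXiv:2401.12397 (2024), §4 pp. 26–28 ((29), (31)). [KozmaNitzan2024]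
-/

noncomputable section

open MeasureTheory
open scoped ENNReal Classical

namespace Summit.CriticalPhenomena.PercolationContinuityZ3.Theorems.FK

open Literature.Probability.Percolation Literature.Probability.LatticeModels SimpleGraph
open Literature.Probability.Percolation.GadgetSystem Literature.Probability.Percolation.KozmaNitzan
open ProbeHistory HSiteScheme KSch Cells

variable {d : ℕ}

namespace RunFK

variable (S : KSch d) (q : ℝ)

/-! ## Unfolding the scheme -/

/-- The explorer of the scheme is `nextProbe`. [folklore] -/
theorem scheme_next : (schemeFK S q).E.next = (nextProbeFK S q) := rfl

/-- The success criterion of the scheme is `succ`. [folklore] -/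
theorem scheme_succ : (schemeFK S q).succ = (succFK S q) := rfl

/-- The initial edges of the scheme are `U₀`. [folklore] -/
theorem scheme_U₀ : (schemeFK S q).U₀ = S.U₀ := rfl

/-- The history of the run after `n` steps. [folklore] -/
abbrev hst (ω : BondConfig (Site d)) (n : ℕ) : ProbeHistory (Site d) := (schemeFK S q).E.hist n ω

/-- The macro-state of the run is the replay of its history. [folklore] -/
theorem stN_eq (n : ℕ) (ω : BondConfig (Site d)) : (schemeFK S q).stN n ω = HSiteScheme.mstOf (succFK S q) ((hst S q) ω n) := rfl

/-- **The three cases of a step**: no probe, or a valid history with a chosen edge, examined by the probe.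
[folklore] -/
theorem next_cases (ω : BondConfig (Site d)) (n : ℕ) :
    (schemeFK S q).E.next ((hst S q) ω n) = none ∨
      ∃ e, ((schemeFK S q).stN n ω).choice = some e ∧ (ValidFK S q) ((hst S q) ω n) e ∧ (schemeFK S q).E.next ((hst S q) ω n) = some ((probeFK S q) ((hst S q) ω n) e) := by
  rw [scheme_next]
  cases hP : (nextProbeFK S q) ((hst S q) ω n) with
  | none => exact Or.inl rfl
  | some P =>
    obtain ⟨e, hc, hV, rfl⟩ := nextProbeFK_eq_some hP
    exact Or.inr ⟨e, hc, hV, rfl⟩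

/-- If a probe is made then it is the examination of the chosen edge after a valid history. [folklore] -/
theorem of_next_some {ω : BondConfig (Site d)} {n : ℕ} {P : AProbe (Site d)} (hP : (schemeFK S q).E.next ((hst S q) ω n) = some P) :
    ∃ e, ((schemeFK S q).stN n ω).choice = some e ∧ (ValidFK S q) ((hst S q) ω n) e ∧ P = (probeFK S q) ((hst S q) ω n) e := by
  rw [scheme_next] at hP
  exact nextProbeFK_eq_some hP

/-! ## The evolution of `F`, `V`, `ξ` -/

/-- `F` only grows along the run. [folklore] -/
theorem F_mono (ω : BondConfig (Site d)) : Monotone fun n => S.F ((hst S q) ω n) := by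
  refine monotone_nat_of_le_succ fun n => ?_
  show S.F ((hst S q) ω n) ⊆ S.F ((hst S q) ω (n + 1))
  exact S.F_subset_cons _ _

/-- `V` only grows along the run. [folklore] -/
theorem V_mono (ω : BondConfig (Site d)) : Monotone fun n => S.V ((hst S q) ω n) := fun _ _ hmn =>
  span_mono ((F_mono S q) ω hmn)

/-- No probe: `F`, `ξ` and the macro-state are unchanged. [folklore] -/
theorem step_none {ω : BondConfig (Site d)} {n : ℕ} (hD : (schemeFK S q).E.next ((hst S q) ω n) = none) :
    S.F ((hst S q) ω (n + 1)) = S.F ((hst S q) ω n) ∧ S.ξ ((hst S q) ω (n + 1)) = S.ξ ((hst S q) ω n) ∧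
      (schemeFK S q).stN (n + 1) ω = (schemeFK S q).stN n ω := by
  have h1 : (hst S q) ω (n + 1) = none :: (hst S q) ω n := by
    show (schemeFK S q).E.hist (n + 1) ω = _
    rw [AExplorer.hist_succ, (schemeFK S q).E.step_of_none hD]
  rw [h1, KSch.F_cons_none, KSch.ξ_cons_none]
  exact ⟨rfl, rfl, (schemeFK S q).stN_succ_of_next_none hD⟩

/-- A probe along `e`: `F` gains the revealed edges, `ξ` the observed ones, and the macro-state is
updated by the success of the examination. [cite: KozmaNitzan2024, §4 p. 27 (E_{i+1}, G_{i+1}, X_{i+1})] -/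
theorem step_some {ω : BondConfig (Site d)} {n : ℕ} {e : Site 2 × MDir} (hc : ((schemeFK S q).stN n ω).choice = some e)
    (hD : (schemeFK S q).E.next ((hst S q) ω n) = some ((probeFK S q) ((hst S q) ω n) e)) :
    S.F ((hst S q) ω (n + 1)) = S.F ((hst S q) ω n) ∪ (revealOfFK S q) ((hst S q) ω n) e (obs ω (S.env ((hst S q) ω n) e)) ∧
      S.ξ ((hst S q) ω (n + 1)) = S.ξ ((hst S q) ω n) ∪ obs ω ((revealOfFK S q) ((hst S q) ω n) e (obs ω (S.env ((hst S q) ω n) e))) ∧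
      (schemeFK S q).stN (n + 1) ω = ((schemeFK S q).stN n ω).update e ((succFK S q) ((hst S q) ω n) e (((probeFK S q) ((hst S q) ω n) e).read ω)) := by
  have h1 : (hst S q) ω (n + 1) = some (((probeFK S q) ((hst S q) ω n) e).record ω) :: (hst S q) ω n := by
    show (schemeFK S q).E.hist (n + 1) ω = _
    rw [AExplorer.hist_succ, (schemeFK S q).E.step_of_some hD]
  refine ⟨by rw [h1, KSch.F_cons_some]; rfl, by rw [h1, KSch.ξ_cons_some]; rfl, ?_⟩
  rw [(schemeFK S q).stN_succ_of_next_some hD, hc]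
  rfl

/-! ## The new region is covered by its own lattice edges -/

/-- Every vertex of the new region has a lattice neighbour in it. [folklore] -/
theorem exists_adj_of_mem_newRegion (h : ProbeHistory (Site d)) (e : Site 2 × MDir) (o : Finset (Sym2 (Site d)))
    {y : Site d} (hy : y ∈ (newRegionFK S q) h e o) : ∃ z ∈ (newRegionFK S q) h e o, (zdGraph d).Adj y z := by
  have hr1 : (1 : ℤ) ≤ S.C.r := by exact_mod_cast S.C.r_pos
  have hd : 0 < d := by have := S.C.hd; omega
  rcases Finset.mem_union.1 hy with hy | hy
  · rcases Finset.mem_union.1 hy with hy | hy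
    · obtain ⟨z, hz, hadj⟩ := S.C.exists_adj_of_mem_sBox (by linarith) hy
      exact ⟨z, Finset.mem_union_left _ (Finset.mem_union_left _ hz), hadj⟩
    · obtain ⟨z, hz, hadj⟩ := exists_adj_of_mem_cIcc hd (by have := S.C.r_pos; omega) hy
      exact ⟨z, Finset.mem_union_left _ (Finset.mem_union_right _ hz), hadj⟩
  · obtain ⟨du, hdu, hy⟩ := Finset.mem_biUnion.1 hy
    obtain ⟨z, hz, hadj⟩ := S.C.exists_adj_of_mem_sBox (by linarith) hy
    exact ⟨z, Finset.mem_union_right _ (Finset.mem_biUnion.2 ⟨du, hdu, hz⟩), hadj⟩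

/-! ## The run invariant -/

/-- **The invariant of the run after `n` steps**: the explored edges are the lattice edges inside the
explored region; the recorded pattern is `ω` on the explored edges, with `U₀` recorded open; the
explored region consists of `Q_0` and the new regions of the probes made; the cube of every
determined macro-vertex is explored ((29)). [cite: KozmaNitzan2024, §4 pp. 26–27 ((29), E_{i+1})] -/
structure RunInv (ω : BondConfig (Site d)) (n : ℕ) : Prop where
  F_eq : S.F ((hst S q) ω n) = edgesIn (zdGraph d) (S.V ((hst S q) ω n))
  ξ_iff : ∀ x, x ∈ S.ξ ((hst S q) ω n) ↔ x ∈ S.F ((hst S q) ω n) ∧ (x ∈ ω ∨ x ∈ S.U₀)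
  V_cases : ∀ y ∈ S.V ((hst S q) ω n), y ∈ S.C.Q 0 ∨ ∃ m < n, ∃ e, ((schemeFK S q).stN m ω).choice = some e ∧
    (ValidFK S q) ((hst S q) ω m) e ∧ (schemeFK S q).E.next ((hst S q) ω m) = some ((probeFK S q) ((hst S q) ω m) e) ∧
    y ∈ (newRegionFK S q) ((hst S q) ω m) e (obs ω (S.env ((hst S q) ω m) e))
  det_Q : ∀ x, ((schemeFK S q).stN n ω).Det x → S.C.Q x ⊆ S.V ((hst S q) ω n)

/-- The step of the explored region at a probe: `E_{i+1} = E_i ∪ E_{w,v} ∪ ⋃_x H^{j_x}_{v,x}`, and the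
explored edges stay the lattice edges inside. [cite: KozmaNitzan2024, §4 p. 27 (E_{i+1})] -/
theorem V_step {ω : BondConfig (Site d)} {n : ℕ} (hI : (RunInv S q) ω n) {e : Site 2 × MDir}
    (hc : ((schemeFK S q).stN n ω).choice = some e) (hD : (schemeFK S q).E.next ((hst S q) ω n) = some ((probeFK S q) ((hst S q) ω n) e)) :
    S.F ((hst S q) ω (n + 1)) = edgesIn (zdGraph d) (S.V ((hst S q) ω n) ∪ (newRegionFK S q) ((hst S q) ω n) e (obs ω (S.env ((hst S q) ω n) e))) ∧
      S.V ((hst S q) ω (n + 1)) = S.V ((hst S q) ω n) ∪ (newRegionFK S q) ((hst S q) ω n) e (obs ω (S.env ((hst S q) ω n) e)) := by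
  obtain ⟨hF, -, -⟩ := (step_some S q) hc hD
  have hF' : S.F ((hst S q) ω (n + 1)) =
      edgesIn (zdGraph d) (S.V ((hst S q) ω n) ∪ (newRegionFK S q) ((hst S q) ω n) e (obs ω (S.env ((hst S q) ω n) e))) := by
    rw [hF, revealOfFK, Finset.union_sdiff_self_eq_union]
    refine Finset.union_eq_right.2 ?_
    rw [hI.F_eq]
    intro x hx
    rw [mem_edgesIn_iff] at hx ⊢
    exact ⟨hx.1, fun y hy => Finset.mem_union_left _ (hx.2 y hy)⟩
  refine ⟨hF', ?_⟩
  show span (S.F ((hst S q) ω (n + 1))) = _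
  rw [hF']
  refine span_edgesIn_eq fun y hy => ?_
  rcases Finset.mem_union.1 hy with hy | hy
  · have hy' : y ∈ span (edgesIn (zdGraph d) (S.V ((hst S q) ω n))) := by
      rw [← hI.F_eq]; exact hy
    obtain ⟨z, hz, hadj⟩ := exists_adj_of_mem_span_edgesIn hy'
    exact ⟨z, Finset.mem_union_left _ hz, hadj⟩
  · obtain ⟨z, hz, hadj⟩ := (exists_adj_of_mem_newRegion S q) _ _ _ hy
    exact ⟨z, Finset.mem_union_right _ hz, hadj⟩

/-- **The invariant holds along the run.** [cite: KozmaNitzan2024, §4 pp. 26–27] -/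
theorem runInv (ω : BondConfig (Site d)) : ∀ n, (RunInv S q) ω n
  | 0 => by
    have hV : S.V ((hst S q) ω 0) = S.C.Q 0 := KSch.V_nil S
    have hF : S.F ((hst S q) ω 0) = S.U₀ := by
      show S.F [] = S.U₀
      unfold KSch.F; rw [supp_nil, Finset.union_empty]
    refine ⟨?_, ?_, ?_, ?_⟩
    · rw [hV, hF]; rfl
    · intro x
      have hξ : S.ξ ((hst S q) ω 0) = S.U₀ := by
        show S.ξ [] = S.U₀
        unfold KSch.ξ; rw [opens_nil, Finset.union_empty]
      rw [hξ, hF]; tauto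
    · intro y hy; rw [hV] at hy; exact Or.inl hy
    · intro x hx
      have hx' : x = 0 := by
        rcases hx with hx | hx
        · simpa [HSiteScheme.stN, HSiteScheme.mst, HState.start] using hx
        · simp [HSiteScheme.stN, HSiteScheme.mst, HState.start] at hx
      rw [hx', hV]
  | n + 1 => by
    have hI := runInv ω n
    rcases (next_cases S q) ω n with hD | ⟨e, hc, hV, hD⟩
    · obtain ⟨hF, hξ, hstN⟩ := (step_none S q) hD
      have hVV : S.V ((hst S q) ω (n + 1)) = S.V ((hst S q) ω n) := by
        show span _ = span _; rw [hF]
      refine ⟨?_, ?_, ?_, ?_⟩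
      · rw [hF, hVV]; exact hI.F_eq
      · intro x; rw [hξ, hF]; exact hI.ξ_iff x
      · intro y hy
        rw [hVV] at hy
        rcases hI.V_cases y hy with h | ⟨m, hm, rest⟩
        · exact Or.inl h
        · exact Or.inr ⟨m, by omega, rest⟩
      · intro x hx
        rw [hstN] at hx; rw [hVV]; exact hI.det_Q x hx
    · obtain ⟨hF1, hξ1, hstN⟩ := (step_some S q) hc hD
      obtain ⟨hF2, hV2⟩ := (V_step S q) hI hc hD
      refine ⟨?_, ?_, ?_, ?_⟩
      · rw [hF2, hV2]
      · intro x
        rw [hξ1, hF1, Finset.mem_union, Finset.mem_union, mem_obs_iff, hI.ξ_iff x]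
        constructor
        · rintro (⟨hxF, h'⟩ | ⟨hxr, hxω⟩)
          · exact ⟨Or.inl hxF, h'⟩
          · exact ⟨Or.inr hxr, Or.inl hxω⟩
        · rintro ⟨hxF | hxr, h'⟩
          · exact Or.inl ⟨hxF, h'⟩
          · by_cases hxF : x ∈ S.F ((hst S q) ω n)
            · exact Or.inl ⟨hxF, h'⟩
            · rcases h' with h' | h'
              · exact Or.inr ⟨hxr, h'⟩
              · exact absurd (KSch.U₀_subset_F S _ h') hxF
      · intro y hy
        rw [hV2] at hy
        rcases Finset.mem_union.1 hy with hy | hy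
        · rcases hI.V_cases y hy with h | ⟨m, hm, rest⟩
          · exact Or.inl h
          · exact Or.inr ⟨m, by omega, rest⟩
        · exact Or.inr ⟨n, Nat.lt_succ_self n, e, hc, hV, hD, hy⟩
      · intro x hx
        rw [hstN] at hx
        rw [hV2]
        rcases (HState.det_update_iff _ _ _).1 hx with rfl | hx
        · intro y hy
          refine Finset.mem_union_right _ (Finset.mem_union_left _ (Finset.mem_union_right _ ?_))
          exact hy
        · exact (hI.det_Q x hx).trans Finset.subset_union_left

end RunFK

end Summit.CriticalPhenomena.PercolationContinuityZ3.Theorems.FK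

end
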